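import Literature.Probability.LatticeModels.DiscreteRectBoundaryTrace
import Mathlib.Analysis.Real.Sqrt
import Mathlib.Algebra.Order.Chebyshev
import HarnessLib

/-!
# Discrete Stokes on a topological rectangle and the upper bound
# `ℓ_Ω̄[(a_ext b_ext),(c_ext d_ext)] · ℓ_Ω̄[(b_ext c_ext),(d_ext a_ext)] ≤ K`

Support file for `Literature.Probability.LatticeModels.discreteEL_ext_selfDual`
(Chelkak–Duminil-Copin–Hongler 2016, §3.3, self-duality of discrete extremal lengths), upper half.
For a rectangle `IsRect E d₀ n` with completed graph `Ω̄ = extGraph E` and ANY two potentials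
`u, w : Ω̄ → ℝ` with `u ≡ 1` on the external arc `A = extArc 0`, `u ≡ 0` on `C = extArc 2`,
`w ≡ 1` on `B = extArc 1`, `w ≡ 0` on `D = extArc 3`, we prove the **discrete area inequality**

  `1 ≤ K · √(ℰ(u)) · √(ℰ(w))`       (`DiscreteRect.IsRect.one_le_mul_sqrt_energy`)

with an absolute constant `K`, `ℰ` the unit-conductance Dirichlet energy of `Ω̄`; by Dirichlet's
principle (`effectiveConductance` is the infimum of admissible energies) this is
`𝒞(A ↔ C) · 𝒞(B ↔ D) ≥ K⁻²`, i.e. the upper bound `ℓ_Ω̄[A,C] · ℓ_Ω̄[B,D] ≤ K²`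
(`DiscreteRect.IsRect.extResistance_mul_extResistance_le`). This is the lattice version of the
classical argument `1 = ∫_Ω du ∧ dw ≤ ‖∇u‖ ‖∇w‖` for a conformal rectangle: the polygon sum
`Σ_i U_i (W_{i+1} - W_i)` over the cyclically ordered external vertices equals `1` up to two corner
products (boundary values), and is turned into a sum of local "wedge" terms over the faces and the
boundary quads of the domain by the traversal bijection of `DiscreteRectBoundaryTrace`
(`IsRect.sum_slots_eq`: the boundary cycle is the boundary of the union of the faces); every local
term is a product of increments of `u` and of `w` around one face, and Cauchy–Schwarz finishes.
The printed source deduces the statement instead from the comparison with continuous extremal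
lengths (Chelkak 2016, Prop. 6.2, Cor. 6.3), which Mathlib cannot express yet; the present discrete
road gives a (much) worse but absolute constant. Everything is proved; no named fact is introduced.

## References
* D. Chelkak, H. Duminil-Copin, C. Hongler, EJP 21 (2016) no. 5, §3.3. [ChelkakDuminilCopinHongler2016]
* D. Chelkak, *Robust discrete complex analysis: a toolbox*, Ann. Probab. 44 (2016), §6,
  Prop. 6.2, Cor. 6.3. [Chelkak2016]
-/

noncomputable section

open scoped ENNReal NNReal
open Finset

namespace Literature.Probability.LatticeModels

namespace DiscreteRect

/-! ### Two elementary inequalities for sequences -/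

section Sequences

/-- **The wedge of a closed polygon of values is a sum of local products**: for sequences `uu, ww`,
`Σ_{j<m} uu_j (ww_{j+1} - ww_j) - uu_0 (ww_m - ww_0) = Σ_{j<m} (uu_j - uu_0)(ww_{j+1} - ww_j)`, and
`|uu_j - uu_0|` is at most the total variation; hence the bound by the product of the total
variations. [folklore] -/
theorem abs_wedge_le (uu ww : ℕ → ℝ) (m : ℕ) :
    |∑ j ∈ range m, uu j * (ww (j + 1) - ww j) - uu 0 * (ww m - ww 0)| ≤
      (∑ j ∈ range m, |uu (j + 1) - uu j|) * ∑ j ∈ range m, |ww (j + 1) - ww j| := by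
  have htel : uu 0 * (ww m - ww 0) = ∑ j ∈ range m, uu 0 * (ww (j + 1) - ww j) := by
    rw [← mul_sum, sum_range_sub]
  have hvar : ∀ j ≤ m, |uu j - uu 0| ≤ ∑ l ∈ range m, |uu (l + 1) - uu l| := fun j hj ↦ by
    rw [← sum_range_sub (fun l ↦ uu l) j]
    exact (abs_sum_le_sum_abs _ _).trans
      (sum_le_sum_of_subset_of_nonneg (range_subset_range.2 hj) fun _ _ _ ↦ abs_nonneg _)
  rw [htel, ← sum_sub_distrib]
  calc |∑ j ∈ range m, (uu j * (ww (j + 1) - ww j) - uu 0 * (ww (j + 1) - ww j))|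
      ≤ ∑ j ∈ range m, |uu j * (ww (j + 1) - ww j) - uu 0 * (ww (j + 1) - ww j)| :=
        abs_sum_le_sum_abs _ _
    _ = ∑ j ∈ range m, |uu j - uu 0| * |ww (j + 1) - ww j| := by
        refine sum_congr rfl fun j _ ↦ ?_
        rw [← abs_mul]
        ring_nf
    _ ≤ ∑ j ∈ range m, (∑ l ∈ range m, |uu (l + 1) - uu l|) * |ww (j + 1) - ww j| :=
        sum_le_sum fun j hj ↦ mul_le_mul_of_nonneg_right
          (hvar j (mem_range.1 hj).le) (abs_nonneg _)
    _ = _ := by rw [mul_sum]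

/-- The square of the total variation of `m` steps is at most `m` times the sum of squared steps.
[folklore] -/
theorem sq_variation_le (uu : ℕ → ℝ) (m : ℕ) :
    (∑ j ∈ range m, |uu (j + 1) - uu j|) ^ 2 ≤ m * ∑ j ∈ range m, (uu (j + 1) - uu j) ^ 2 := by
  have h := sq_sum_le_card_mul_sum_sq (s := range m) (f := fun j ↦ |uu (j + 1) - uu j|)
  simp only [card_range, sq_abs] at h
  exact h

/-- The square of the total increment of `m` steps is at most `m` times the sum of squared steps.
[folklore] -/
theorem sq_incr_le (uu : ℕ → ℝ) (m : ℕ) :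
    (uu m - uu 0) ^ 2 ≤ m * ∑ j ∈ range m, (uu (j + 1) - uu j) ^ 2 := by
  refine le_trans ?_ (sq_variation_le uu m)
  rw [← sum_range_sub (fun l ↦ uu l) m, ← sq_abs]
  exact pow_le_pow_left₀ (abs_nonneg _) (abs_sum_le_sum_abs _ _) 2

/-- **The wedge bound, squared**: with `m ≤ 5` steps,
`(Σ uu_j Δww_j - uu_0 (ww_m - ww_0))² ≤ 25 · Σ (Δuu)² · Σ (Δww)²`. [folklore] -/
theorem wedge_sq_le (uu ww : ℕ → ℝ) {m : ℕ} (hm : m ≤ 5) :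
    (∑ j ∈ range m, uu j * (ww (j + 1) - ww j) - uu 0 * (ww m - ww 0)) ^ 2 ≤
      25 * (∑ j ∈ range m, (uu (j + 1) - uu j) ^ 2) * ∑ j ∈ range m, (ww (j + 1) - ww j) ^ 2 := by
  have hA := sq_variation_le uu m
  have hB := sq_variation_le ww m
  have h := abs_wedge_le uu ww m
  have hm' : (m : ℝ) ≤ 5 := by exact_mod_cast hm
  have hSu : 0 ≤ ∑ j ∈ range m, (uu (j + 1) - uu j) ^ 2 := sum_nonneg fun _ _ ↦ sq_nonneg _
  have hSw : 0 ≤ ∑ j ∈ range m, (ww (j + 1) - ww j) ^ 2 := sum_nonneg fun _ _ ↦ sq_nonneg _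
  have hVu : 0 ≤ ∑ j ∈ range m, |uu (j + 1) - uu j| := sum_nonneg fun _ _ ↦ abs_nonneg _
  have hVw : 0 ≤ ∑ j ∈ range m, |ww (j + 1) - ww j| := sum_nonneg fun _ _ ↦ abs_nonneg _
  calc (∑ j ∈ range m, uu j * (ww (j + 1) - ww j) - uu 0 * (ww m - ww 0)) ^ 2
      ≤ ((∑ j ∈ range m, |uu (j + 1) - uu j|) * ∑ j ∈ range m, |ww (j + 1) - ww j|) ^ 2 := by
        rw [← sq_abs]
        exact pow_le_pow_left₀ (abs_nonneg _) h 2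
    _ = (∑ j ∈ range m, |uu (j + 1) - uu j|) ^ 2 * (∑ j ∈ range m, |ww (j + 1) - ww j|) ^ 2 := by
        ring
    _ ≤ (m * ∑ j ∈ range m, (uu (j + 1) - uu j) ^ 2) *
          (m * ∑ j ∈ range m, (ww (j + 1) - ww j) ^ 2) :=
        mul_le_mul hA hB (sq_nonneg _) (by positivity)
    _ ≤ (5 * ∑ j ∈ range m, (uu (j + 1) - uu j) ^ 2) *
          (5 * ∑ j ∈ range m, (ww (j + 1) - ww j) ^ 2) := by
        gcongr
    _ = _ := by ring

end Sequences

/-! ### Local quantities attached to arrows, darts and faces -/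

section Local

variable (E : Finset (Sym2 (Site 2))) (u w : Site 2 ⊕ (Site 2 × Fin 4) → ℝ)

/-- The non-symmetrised wedge density `u_p (w_q - w_p)` of the arrow `p → q = p + e_m`. [folklore] -/
def th (a : Site 2 × Fin 4) : ℝ :=
  u (.inl a.1) * (w (.inl (a.1 + dir a.2)) - w (.inl a.1))

/-- The increment of `u` along the arrow `a`. [folklore] -/
def dA (a : Site 2 × Fin 4) : ℝ :=
  u (.inl (a.1 + dir a.2)) - u (.inl a.1)

/-- The increment of `u` along the pendant edge of the dart `d`, from the external vertex to its
base. [folklore] -/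
def dP (d : Site 2 × Fin 4) : ℝ :=
  u (.inl d.1) - u (.inr d)

/-- **The wedge of the boundary quad of the dart `d`**: the sum of `u_p (w_q - w_p)` along the
real edges `ext(d) → x → (segment) → x' → ext(d')` of the quad (`d' = succ E d`), minus the polygon
term `U (W' - U)` of its virtual side `ext(d) → ext(d')`. [folklore] -/
def quadX (d : Site 2 × Fin 4) : ℝ :=
  u (.inr d) * (w (.inl d.1) - w (.inr d)) + ∑ a ∈ slots E d, th u w a +
      u (.inl (succ E d).1) * (w (.inr (succ E d)) - w (.inl (succ E d).1)) -
    u (.inr d) * (w (.inr (succ E d)) - w (.inr d))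

/-- The sum of squared increments of `u` along the real edges of the boundary quad of `d`.
[folklore] -/
def quadS (d : Site 2 × Fin 4) : ℝ :=
  dP u d ^ 2 + ∑ a ∈ slots E d, dA u a ^ 2 + dP u (succ E d) ^ 2

variable {E}

/-- Sums over a segment, by cases (the three candidate arrows have distinct directions).
[folklore] -/
theorem sum_slots_eq_ite {M : Type*} [AddCommMonoid M] (f : Site 2 × Fin 4 → M)
    (d : Site 2 × Fin 4) :
    ∑ a ∈ slots E d, f a =
      if s(d.1, d.1 + dir (d.2 + 1)) ∉ E then 0
      else if s(d.1 + dir (d.2 + 1), d.1 + dir (d.2 + 1) + dir d.2) ∉ E then f (d.1, d.2 + 1)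
      else if s(d.1 + dir (d.2 + 1) + dir d.2, d.1 + dir (d.2 + 1) + dir d.2 + dir (d.2 - 1)) ∉ E then
        f (d.1, d.2 + 1) + f (d.1 + dir (d.2 + 1), d.2)
      else f (d.1, d.2 + 1) + f (d.1 + dir (d.2 + 1), d.2) +
        f (d.1 + dir (d.2 + 1) + dir d.2, d.2 - 1) := by
  have h12 : (d.1, d.2 + 1) ≠ (d.1 + dir (d.2 + 1), d.2) := fun h ↦ by
    have := congrArg Prod.snd h; simp at this
  have k2 : ∀ k : Fin 4, k + 1 ≠ k - 1 := by decide
  have k3 : ∀ k : Fin 4, k ≠ k - 1 := by decide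
  have h13 : (d.1, d.2 + 1) ≠ (d.1 + dir (d.2 + 1) + dir d.2, d.2 - 1) := fun h ↦
    k2 d.2 (congrArg Prod.snd h)
  have h23 : (d.1 + dir (d.2 + 1), d.2) ≠ (d.1 + dir (d.2 + 1) + dir d.2, d.2 - 1) := fun h ↦
    k3 d.2 (congrArg Prod.snd h)
  unfold slots
  dsimp only
  split_ifs with h1 h2 h3
  · rw [sum_insert (by simp [h12, h13]), sum_pair h23]
    exact (add_assoc _ _ _).symm
  · rw [sum_pair h12]
  · rw [sum_singleton]
  · rfl

/-- **The quad wedge bound**: `quadX² ≤ 25 · quadS(u) · quadS(w)` — the wedge of a boundary quad is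
controlled by the squared increments of `u` and `w` along its (at most five) real edges.
[folklore] -/
theorem quadX_sq_le (d : Site 2 × Fin 4) :
    quadX E u w d ^ 2 ≤ 25 * quadS E u d * quadS E w d := by
  -- the vertex sequence of the quad, by cases on the segment
  unfold quadX quadS
  rw [sum_slots_eq_ite, sum_slots_eq_ite, sum_slots_eq_ite]
  unfold DiscreteRect.succ
  simp only [th, dA, dP]
  split_ifs with h1 h2 h3
  · -- three arrows
    let vs : List (Site 2 ⊕ (Site 2 × Fin 4)) :=
      [.inr d, .inl d.1, .inl (d.1 + dir (d.2 + 1)), .inl (d.1 + dir (d.2 + 1) + dir d.2),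
        .inl (d.1 + dir (d.2 + 1) + dir d.2 + dir (d.2 - 1)),
        .inr (d.1 + dir (d.2 + 1) + dir d.2 + dir (d.2 - 1), d.2 - 2)]
    have h := wedge_sq_le (fun j ↦ u (vs.getD j (.inl 0))) (fun j ↦ w (vs.getD j (.inl 0)))
      (m := 5) le_rfl
    simp only [sum_range_succ, sum_range_zero, zero_add, vs, List.getD_cons_succ,
      List.getD_cons_zero] at h
    convert h using 2 <;> ring
  · -- two arrows
    let vs : List (Site 2 ⊕ (Site 2 × Fin 4)) :=
      [.inr d, .inl d.1, .inl (d.1 + dir (d.2 + 1)), .inl (d.1 + dir (d.2 + 1) + dir d.2),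
        .inr (d.1 + dir (d.2 + 1) + dir d.2, d.2 - 1)]
    have h := wedge_sq_le (fun j ↦ u (vs.getD j (.inl 0))) (fun j ↦ w (vs.getD j (.inl 0)))
      (m := 4) (by norm_num)
    simp only [sum_range_succ, sum_range_zero, zero_add, vs, List.getD_cons_succ,
      List.getD_cons_zero] at h
    convert h using 2 <;> ring
  · -- one arrow
    let vs : List (Site 2 ⊕ (Site 2 × Fin 4)) :=
      [.inr d, .inl d.1, .inl (d.1 + dir (d.2 + 1)), .inr (d.1 + dir (d.2 + 1), d.2)]
    have h := wedge_sq_le (fun j ↦ u (vs.getD j (.inl 0))) (fun j ↦ w (vs.getD j (.inl 0)))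
      (m := 3) (by norm_num)
    simp only [sum_range_succ, sum_range_zero, zero_add, vs, List.getD_cons_succ,
      List.getD_cons_zero] at h
    convert h using 2 <;> ring
  · -- no arrow: the quad is the triangle `ext(d), x, ext(d')`
    let vs : List (Site 2 ⊕ (Site 2 × Fin 4)) := [.inr d, .inl d.1, .inr (d.1, d.2 + 1)]
    have h := wedge_sq_le (fun j ↦ u (vs.getD j (.inl 0))) (fun j ↦ w (vs.getD j (.inl 0)))
      (m := 2) (by norm_num)
    simp only [sum_range_succ, sum_range_zero, zero_add, vs, List.getD_cons_succ,
      List.getD_cons_zero] at h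
    convert h using 2 <;> ring

/-- **The increment of `u` between consecutive external vertices is controlled by the quad**:
`(U' - U)² ≤ 5 · quadS(u)`. [folklore] -/
theorem dExt_sq_le (d : Site 2 × Fin 4) :
    (u (.inr (succ E d)) - u (.inr d)) ^ 2 ≤ 5 * quadS E u d := by
  unfold quadS
  rw [sum_slots_eq_ite]
  unfold DiscreteRect.succ
  simp only [dA, dP]
  split_ifs with h1 h2 h3
  · let vs : List (Site 2 ⊕ (Site 2 × Fin 4)) :=
      [.inr d, .inl d.1, .inl (d.1 + dir (d.2 + 1)), .inl (d.1 + dir (d.2 + 1) + dir d.2),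
        .inl (d.1 + dir (d.2 + 1) + dir d.2 + dir (d.2 - 1)),
        .inr (d.1 + dir (d.2 + 1) + dir d.2 + dir (d.2 - 1), d.2 - 2)]
    have h := sq_incr_le (fun j ↦ u (vs.getD j (.inl 0))) 5
    simp only [sum_range_succ, sum_range_zero, zero_add, vs, List.getD_cons_succ,
      List.getD_cons_zero, Nat.cast_ofNat] at h
    convert h using 2; ring
  · let vs : List (Site 2 ⊕ (Site 2 × Fin 4)) :=
      [.inr d, .inl d.1, .inl (d.1 + dir (d.2 + 1)), .inl (d.1 + dir (d.2 + 1) + dir d.2),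
        .inr (d.1 + dir (d.2 + 1) + dir d.2, d.2 - 1)]
    have h := sq_incr_le (fun j ↦ u (vs.getD j (.inl 0))) 4
    simp only [sum_range_succ, sum_range_zero, zero_add, vs, List.getD_cons_succ,
      List.getD_cons_zero, Nat.cast_ofNat] at h
    calc _ ≤ (4 : ℝ) * _ := h
      _ ≤ 5 * _ := by gcongr; norm_num
      _ = _ := by ring
  · let vs : List (Site 2 ⊕ (Site 2 × Fin 4)) :=
      [.inr d, .inl d.1, .inl (d.1 + dir (d.2 + 1)), .inr (d.1 + dir (d.2 + 1), d.2)]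
    have h := sq_incr_le (fun j ↦ u (vs.getD j (.inl 0))) 3
    simp only [sum_range_succ, sum_range_zero, zero_add, vs, List.getD_cons_succ,
      List.getD_cons_zero, Nat.cast_ofNat] at h
    calc _ ≤ (3 : ℝ) * _ := h
      _ ≤ 5 * _ := by gcongr; norm_num
      _ = _ := by ring
  · let vs : List (Site 2 ⊕ (Site 2 × Fin 4)) := [.inr d, .inl d.1, .inr (d.1, d.2 + 1)]
    have h := sq_incr_le (fun j ↦ u (vs.getD j (.inl 0))) 2
    simp only [sum_range_succ, sum_range_zero, zero_add, vs, List.getD_cons_succ,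
      List.getD_cons_zero, Nat.cast_ofNat] at h
    calc _ ≤ (2 : ℝ) * _ := h
      _ ≤ 5 * _ := by gcongr; norm_num
      _ = _ := by ring

/-- **The face wedge bound**: for a unit square `s`, the wedge `Σ_j u(c_j)(w(c_{j+1}) - w(c_j))`
around its four sides satisfies `wedge² ≤ 25 · Σ_j du_j² · Σ_j dw_j²`. [folklore] -/
theorem face_wedge_sq_le (s : Site 2) :
    (∑ j : Fin 4, th u w (corner s j, j)) ^ 2 ≤
      25 * (∑ j : Fin 4, dA u (corner s j, j) ^ 2) * ∑ j : Fin 4, dA w (corner s j, j) ^ 2 := by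
  let vs : List (Site 2 ⊕ (Site 2 × Fin 4)) :=
    [.inl (corner s 0), .inl (corner s 1), .inl (corner s 2), .inl (corner s 3), .inl (corner s 0)]
  have h := wedge_sq_le (fun j ↦ u (vs.getD j (.inl 0))) (fun j ↦ w (vs.getD j (.inl 0)))
    (m := 4) (by norm_num)
  have e0 : corner s 0 + dir 0 = corner s 1 := (corner_add_one s 0).symm
  have e1 : corner s 1 + dir 1 = corner s 2 := (corner_add_one s 1).symm
  have e2 : corner s 2 + dir 2 = corner s 3 := (corner_add_one s 2).symm
  have e3 : corner s 3 + dir 3 = corner s 0 := (corner_add_one s 3).symm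
  simp only [sum_range_succ, sum_range_zero, zero_add, vs, List.getD_cons_succ,
    List.getD_cons_zero, sub_self, mul_zero, sub_zero] at h
  simp only [Fin.sum_univ_four, th, dA, e0, e1, e2, e3]
  convert h using 2

end Local

/-! ### The polygon sum of the boundary values -/

section Polygon

/-- **The polygon sum is `1` up to two corner products.** For sequences `U, W` on one period
`[0, N)`, `N = n₀ + n₁ + n₂ + n₃` (all `nⱼ ≥ 1`), with `U = 1` on the first block, `W = 1` on the
second, `U = 0` on the third, `W = 0` on the fourth, and `U N = U 0`, `W N = W 0`:
`Σ_{i<N} U_i (W_{i+1} - W_i) = 1 - ΔU_{N-1} ΔW_{N-1} - ΔU_{n₀+n₁-1} ΔW_{n₀+n₁-1}`. [folklore] -/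
theorem polygon_sum_eq (U W : ℕ → ℝ) {n₀ n₁ n₂ n₃ : ℕ} (h₀ : 0 < n₀) (h₁ : 0 < n₁) (h₂ : 0 < n₂)
    (h₃ : 0 < n₃) (hA : ∀ i < n₀, U i = 1) (hB : ∀ i, n₀ ≤ i → i < n₀ + n₁ → W i = 1)
    (hC : ∀ i, n₀ + n₁ ≤ i → i < n₀ + n₁ + n₂ → U i = 0)
    (hD : ∀ i, n₀ + n₁ + n₂ ≤ i → i < n₀ + n₁ + n₂ + n₃ → W i = 0)
    (hU : U (n₀ + n₁ + n₂ + n₃) = U 0) (hW : W (n₀ + n₁ + n₂ + n₃) = W 0) :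
    ∑ i ∈ range (n₀ + n₁ + n₂ + n₃), U i * (W (i + 1) - W i) =
      1 - (U (n₀ + n₁ + n₂ + n₃) - U (n₀ + n₁ + n₂ + n₃ - 1)) *
            (W (n₀ + n₁ + n₂ + n₃) - W (n₀ + n₁ + n₂ + n₃ - 1)) -
        (U (n₀ + n₁) - U (n₀ + n₁ - 1)) * (W (n₀ + n₁) - W (n₀ + n₁ - 1)) := by
  set N := n₀ + n₁ + n₂ + n₃ with hN
  set f : ℕ → ℝ := fun i ↦ U i * (W (i + 1) - W i) with hf
  -- block A
  have sA : ∑ i ∈ range n₀, f i = 1 - W 0 := by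
    have : ∀ i ∈ range n₀, f i = W (i + 1) - W i := fun i hi ↦ by
      simp only [hf, hA i (mem_range.1 hi), one_mul]
    rw [sum_congr rfl this, sum_range_sub, hB n₀ le_rfl (by omega)]
  -- block B
  have sB : ∑ i ∈ Ico n₀ (n₀ + n₁), f i = U (n₀ + n₁ - 1) * (W (n₀ + n₁) - 1) := by
    obtain ⟨m, hm⟩ : ∃ m, n₀ + n₁ = m + 1 := ⟨n₀ + n₁ - 1, by omega⟩
    rw [hm, sum_Ico_succ_top (by omega), Nat.add_sub_cancel]
    have h0 : ∑ i ∈ Ico n₀ m, f i = 0 := sum_eq_zero fun i hi ↦ by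
      rw [mem_Ico] at hi
      simp only [hf, hB i hi.1 (by omega), hB (i + 1) (by omega) (by omega), sub_self, mul_zero]
    rw [h0, zero_add, hf]
    dsimp only
    rw [hB m (by omega) (by omega)]
  -- block C
  have sC : ∑ i ∈ Ico (n₀ + n₁) (n₀ + n₁ + n₂), f i = 0 := sum_eq_zero fun i hi ↦ by
    rw [mem_Ico] at hi
    simp only [hf, hC i hi.1 hi.2, zero_mul]
  -- block D
  have sD : ∑ i ∈ Ico (n₀ + n₁ + n₂) N, f i = U (N - 1) * W 0 := by
    obtain ⟨m, hm⟩ : ∃ m, N = m + 1 := ⟨N - 1, by omega⟩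
    rw [hm, sum_Ico_succ_top (by omega), Nat.add_sub_cancel]
    have h0 : ∑ i ∈ Ico (n₀ + n₁ + n₂) m, f i = 0 := sum_eq_zero fun i hi ↦ by
      rw [mem_Ico] at hi
      simp only [hf, hD i hi.1 (by omega), hD (i + 1) (by omega) (by omega), sub_self, mul_zero]
    rw [h0, zero_add, hf]
    dsimp only
    rw [hD m (by omega) (by omega), sub_zero, ← hm, hW]
  have split : ∑ i ∈ range N, f i = ∑ i ∈ range n₀, f i + ∑ i ∈ Ico n₀ (n₀ + n₁), f i +
      ∑ i ∈ Ico (n₀ + n₁) (n₀ + n₁ + n₂), f i + ∑ i ∈ Ico (n₀ + n₁ + n₂) N, f i := by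
    rw [range_eq_Ico, ← sum_Ico_consecutive f (Nat.zero_le n₀) (show n₀ ≤ N by omega),
      ← sum_Ico_consecutive f (show n₀ ≤ n₀ + n₁ by omega) (show n₀ + n₁ ≤ N by omega),
      ← sum_Ico_consecutive f (show n₀ + n₁ ≤ n₀ + n₁ + n₂ by omega)
        (show n₀ + n₁ + n₂ ≤ N by omega), range_eq_Ico]
    ring
  rw [split, sA, sB, sC, sD, hU, hA 0 h₀, hW, hD (N - 1) (by omega) (by omega),
    hC (n₀ + n₁) le_rfl (by omega), hB (n₀ + n₁ - 1) (by omega) (by omega)]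
  ring

end Polygon

/-! ### Helpers for the assembly -/

section Helpers

/-- A cyclic shift does not change a sum over one period. [folklore] -/
theorem sum_range_succ_shift {M : Type*} [AddCommGroup M] (g : ℕ → M) {N : ℕ} (h : g N = g 0) :
    ∑ i ∈ range N, g (i + 1) = ∑ i ∈ range N, g i := by
  have h1 := sum_range_succ' g N
  have h2 := sum_range_succ g N
  rw [h2, h] at h1
  exact (add_right_cancel h1).symm

/-- **Cauchy–Schwarz for locally controlled terms**: if `t_i² ≤ c F_i G_i` with `F, G ≥ 0`, then
`|Σ t_i| ≤ √c · √(Σ F_i) · √(Σ G_i)`. [folklore] -/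
theorem abs_sum_le_of_sq_le {ι : Type*} (s : Finset ι) (t F G : ι → ℝ) {c : ℝ} (hc : 0 ≤ c)
    (hF : ∀ i, 0 ≤ F i) (hG : ∀ i, 0 ≤ G i) (h : ∀ i ∈ s, t i ^ 2 ≤ c * F i * G i) :
    |∑ i ∈ s, t i| ≤ √c * √(∑ i ∈ s, F i) * √(∑ i ∈ s, G i) := by
  calc |∑ i ∈ s, t i| ≤ ∑ i ∈ s, |t i| := abs_sum_le_sum_abs _ _
    _ ≤ ∑ i ∈ s, √c * (√(F i) * √(G i)) := sum_le_sum fun i hi ↦ by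
        rw [← Real.sqrt_sq_eq_abs, ← Real.sqrt_mul (hF i), ← Real.sqrt_mul hc]
        exact Real.sqrt_le_sqrt (by rw [← mul_assoc]; exact h i hi)
    _ = √c * ∑ i ∈ s, √(F i) * √(G i) := by rw [mul_sum]
    _ ≤ √c * (√(∑ i ∈ s, F i) * √(∑ i ∈ s, G i)) :=
        mul_le_mul_of_nonneg_left (Real.sum_sqrt_mul_sqrt_le s hF hG) (Real.sqrt_nonneg _)
    _ = _ := by ring

/-- A single locally controlled term. [folklore] -/
theorem abs_le_of_sq_le {t F G c : ℝ} (hc : 0 ≤ c) (hF : 0 ≤ F) (h : t ^ 2 ≤ c * F * G) :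
    |t| ≤ √c * √F * √G := by
  rw [← Real.sqrt_sq_eq_abs, ← Real.sqrt_mul hc, ← Real.sqrt_mul (mul_nonneg hc hF)]
  exact Real.sqrt_le_sqrt h

variable (u w : Site 2 ⊕ (Site 2 × Fin 4) → ℝ)

/-- **Reversal pairing of the wedge density**: `u_p (w_q - w_p) + u_q (w_p - w_q) = -du · dw`.
[folklore] -/
theorem th_add_th_rev (a : Site 2 × Fin 4) :
    th u w a + th u w (rev a) = -(dA u a * dA w a) := by
  obtain ⟨p, m⟩ := a
  simp only [th, dA, rev_mk, dir_add_two, add_neg_cancel_right]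
  ring

/-- The squared increment along an arrow is reversal invariant. [folklore] -/
theorem dA_rev_sq (a : Site 2 × Fin 4) : dA u (rev a) ^ 2 = dA u a ^ 2 := by
  obtain ⟨p, m⟩ := a
  simp only [dA, rev_mk, dir_add_two, add_neg_cancel_right]
  ring

variable {E : Finset (Sym2 (Site 2))}

/-- **Pairing**: over a reversal-invariant set of arrows, `Σ th = -½ Σ du · dw`. [folklore] -/
theorem sum_th_filter_eq (P : Site 2 × Fin 4 → Prop) [DecidablePred P]
    (hP : ∀ a, P (rev a) ↔ P a) :
    ∑ a ∈ (arrows E).filter P, th u w a =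
      -(1 / 2) * ∑ a ∈ (arrows E).filter P, dA u a * dA w a := by
  have h := sum_arrows_filter_rev_invariant (E := E) (th u w) P hP
  have h2 : ∑ a ∈ (arrows E).filter P, (th u w a + th u w (rev a)) =
      -∑ a ∈ (arrows E).filter P, dA u a * dA w a := by
    rw [← sum_neg_distrib]
    exact sum_congr rfl fun a _ ↦ th_add_th_rev u w a
  rw [sum_add_distrib, h] at h2
  linarith

/-- Splitting the traversed arrows by the face pattern of their two sides:
`Σ_{¬R} = Σ_{L} + Σ_{¬R ∧ ¬L} - Σ_{L ∧ R}` (`L`/`R`: the left/right square is a face). [folklore] -/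
theorem sum_filter_not_R_eq (f : Site 2 × Fin 4 → ℝ) :
    ∑ a ∈ (arrows E).filter (fun a ↦ ¬ InF E (rsq a)), f a =
      ∑ a ∈ (arrows E).filter (fun a ↦ InF E (lsq a)), f a +
        ∑ a ∈ (arrows E).filter (fun a ↦ ¬ InF E (rsq a) ∧ ¬ InF E (lsq a)), f a -
        ∑ a ∈ (arrows E).filter (fun a ↦ InF E (lsq a) ∧ InF E (rsq a)), f a := by
  have h1 := sum_filter_add_sum_filter_not ((arrows E).filter (fun a ↦ ¬ InF E (rsq a)))
    (fun a ↦ InF E (lsq a)) f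
  have h2 := sum_filter_add_sum_filter_not ((arrows E).filter (fun a ↦ InF E (lsq a)))
    (fun a ↦ ¬ InF E (rsq a)) f
  rw [filter_filter, filter_filter] at h1 h2
  have h3 : (arrows E).filter (fun a ↦ ¬ InF E (rsq a) ∧ InF E (lsq a)) =
      (arrows E).filter (fun a ↦ InF E (lsq a) ∧ ¬ InF E (rsq a)) :=
    filter_congr fun a _ ↦ and_comm
  have h4 : (arrows E).filter (fun a ↦ InF E (lsq a) ∧ ¬¬ InF E (rsq a)) =
      (arrows E).filter (fun a ↦ InF E (lsq a) ∧ InF E (rsq a)) :=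
    filter_congr fun a _ ↦ by rw [not_not]
  rw [h3] at h1
  rw [h4] at h2
  linarith

end Helpers

/-! ### The area inequality `1 ≤ K √ℰ(u) √ℰ(w)` -/

section Assembly

variable {E : Finset (Sym2 (Site 2))} {d₀ : Site 2 × Fin 4} {n : Fin 4 → ℕ}

/-- **The (real, finite-sum) energy of a potential on `Ω̄` along the rectangle `(E, d₀, n)`**:
squared increments over all arrows of `E` (every edge twice) plus squared increments over the
pendant edges of one period of the boundary cycle. [folklore] -/
def rEnergy (E : Finset (Sym2 (Site 2))) (d₀ : Site 2 × Fin 4) (n : Fin 4 → ℕ)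
    (u : Site 2 ⊕ (Site 2 × Fin 4) → ℝ) : ℝ :=
  ∑ a ∈ arrows E, dA u a ^ 2 + ∑ i ∈ range (n 0 + n 1 + n 2 + n 3), dP u ((succ E)^[i] d₀) ^ 2

/-- The real energy is nonnegative. [folklore] -/
theorem rEnergy_nonneg (u : Site 2 ⊕ (Site 2 × Fin 4) → ℝ) : 0 ≤ rEnergy E d₀ n u :=
  add_nonneg (sum_nonneg fun _ _ ↦ sq_nonneg _) (sum_nonneg fun _ _ ↦ sq_nonneg _)

/-- The quad sums over one period are at most twice the energy:
`Σ_i quadS(d_i) = 2·(pendant part) + Σ_{arrows with exterior right square} du² ≤ 2 ℰ`. [folklore] -/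
theorem IsRect.sum_quadS_le (hR : IsRect E d₀ n) (u : Site 2 ⊕ (Site 2 × Fin 4) → ℝ) :
    ∑ i ∈ range (n 0 + n 1 + n 2 + n 3), quadS E u ((succ E)^[i] d₀) ≤ 2 * rEnergy E d₀ n u := by
  have hshift := sum_range_succ_shift (fun i ↦ dP u ((succ E)^[i] d₀) ^ 2)
    (N := n 0 + n 1 + n 2 + n 3) (by simp only [Function.iterate_zero, id_eq, hR.periodic])
  simp only [Function.iterate_succ_apply'] at hshift
  unfold quadS rEnergy
  rw [sum_add_distrib, sum_add_distrib, hshift, hR.sum_slots_eq]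
  have hsub : ∑ a ∈ (arrows E).filter (fun a ↦ ¬ InF E (rsq a)), dA u a ^ 2 ≤
      ∑ a ∈ arrows E, dA u a ^ 2 :=
    sum_le_sum_of_subset_of_nonneg (filter_subset _ _) fun _ _ _ ↦ sq_nonneg _
  have hP : 0 ≤ ∑ a ∈ arrows E, dA u a ^ 2 := sum_nonneg fun _ _ ↦ sq_nonneg _
  linarith

/-- **The discrete area inequality.** For a rectangle `IsRect E d₀ n` and potentials `u, w` on `Ω̄`
with `u = 1` on the external vertices of the arc `A` (positions `[0, n₀)`), `u = 0` on `C`, `w = 1`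
on `B`, `w = 0` on `D`: `1 ≤ 37 · √ℰ(u) · √ℰ(w)` for the real energies `rEnergy`. This is the
lattice form of `1 = ∫ du ∧ dw ≤ ‖∇u‖‖∇w‖` (discrete Stokes through the traversal bijection, local
wedge bounds, Cauchy–Schwarz). [folklore] -/
theorem IsRect.one_le_mul_sqrt_rEnergy (hR : IsRect E d₀ n) (u w : Site 2 ⊕ (Site 2 × Fin 4) → ℝ)
    (huA : ∀ i < n 0, u (.inr ((succ E)^[i] d₀)) = 1)
    (huC : ∀ i, n 0 + n 1 ≤ i → i < n 0 + n 1 + n 2 → u (.inr ((succ E)^[i] d₀)) = 0)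
    (hwB : ∀ i, n 0 ≤ i → i < n 0 + n 1 → w (.inr ((succ E)^[i] d₀)) = 1)
    (hwD : ∀ i, n 0 + n 1 + n 2 ≤ i → i < n 0 + n 1 + n 2 + n 3 →
      w (.inr ((succ E)^[i] d₀)) = 0) :
    1 ≤ 37 * √(rEnergy E d₀ n u) * √(rEnergy E d₀ n w) := by
  have hN0 : 0 < n 0 + n 1 + n 2 + n 3 := by have := hR.pos 0; omega
  have hDsucc : ∀ i, (succ E)^[i + 1] d₀ = succ E ((succ E)^[i] d₀) := fun i ↦
    Function.iterate_succ_apply' _ _ _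
  have hDN : (succ E)^[n 0 + n 1 + n 2 + n 3] d₀ = (succ E)^[0] d₀ := by
    rw [Function.iterate_zero, id_eq]; exact hR.periodic
  -- Step 1: the polygon sum of the boundary values
  set U : ℕ → ℝ := fun i ↦ u (.inr ((succ E)^[i] d₀)) with hU
  set W : ℕ → ℝ := fun i ↦ w (.inr ((succ E)^[i] d₀)) with hW
  have hpoly := polygon_sum_eq U W (hR.pos 0) (hR.pos 1) (hR.pos 2) (hR.pos 3) huA hwB huC hwD
    (by simp only [hU, hDN]) (by simp only [hW, hDN])
  -- Step 2: Stokes — the polygon sum through pendants, traversed arrows and quad wedges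
  set pin : ℕ → ℝ := fun i ↦
    u (.inr ((succ E)^[i] d₀)) * (w (.inl ((succ E)^[i] d₀).1) - w (.inr ((succ E)^[i] d₀)))
    with hpin
  set g : ℕ → ℝ := fun i ↦
    u (.inl ((succ E)^[i] d₀).1) * (w (.inr ((succ E)^[i] d₀)) - w (.inl ((succ E)^[i] d₀).1))
    with hg
  have hstep : ∀ i, U i * (W (i + 1) - W i) = pin i + ∑ a ∈ slots E ((succ E)^[i] d₀), th u w a +
      g (i + 1) - quadX E u w ((succ E)^[i] d₀) := fun i ↦ by
    simp only [hU, hW, hpin, hg, quadX, hDsucc]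
    ring
  have hpg : ∀ i, pin i + g i = -(dP u ((succ E)^[i] d₀) * dP w ((succ E)^[i] d₀)) := fun i ↦ by
    simp only [hpin, hg, dP]; ring
  have hS : ∑ i ∈ range (n 0 + n 1 + n 2 + n 3), U i * (W (i + 1) - W i) =
      -∑ i ∈ range (n 0 + n 1 + n 2 + n 3), dP u ((succ E)^[i] d₀) * dP w ((succ E)^[i] d₀) +
        ∑ a ∈ (arrows E).filter (fun a ↦ ¬ InF E (rsq a)), th u w a -
        ∑ i ∈ range (n 0 + n 1 + n 2 + n 3), quadX E u w ((succ E)^[i] d₀) := by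
    rw [sum_congr rfl fun i _ ↦ hstep i, sum_sub_distrib, sum_add_distrib, sum_add_distrib,
      sum_range_succ_shift g (by simp only [hg, hDN]), ← hR.sum_slots_eq (th u w),
      ← sum_neg_distrib, ← sum_congr rfl fun i _ ↦ hpg i, sum_add_distrib]
    ring
  -- Step 3: traversed arrows = face sides + reversal-invariant remainders
  have hsplit := sum_filter_not_R_eq (E := E) (th u w)
  have hfaces := sum_faces_sides (E := E) (th u w)
  have hpair1 := sum_th_filter_eq (E := E) u w (fun a ↦ ¬ InF E (rsq a) ∧ ¬ InF E (lsq a))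
    (fun a ↦ by simp only [lsq_rev, rsq_rev]; exact and_comm)
  have hpair2 := sum_th_filter_eq (E := E) u w (fun a ↦ InF E (lsq a) ∧ InF E (rsq a))
    (fun a ↦ by simp only [lsq_rev, rsq_rev]; exact and_comm)
  -- Step 4: the bounds
  set Eu := rEnergy E d₀ n u with hEu
  set Ew := rEnergy E d₀ n w with hEw
  have hEu0 : 0 ≤ Eu := rEnergy_nonneg u
  have hEw0 : 0 ≤ Ew := rEnergy_nonneg w
  have hAu : ∑ a ∈ arrows E, dA u a ^ 2 ≤ Eu :=
    le_add_of_nonneg_right (sum_nonneg fun _ _ ↦ sq_nonneg _)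
  have hAw : ∑ a ∈ arrows E, dA w a ^ 2 ≤ Ew :=
    le_add_of_nonneg_right (sum_nonneg fun _ _ ↦ sq_nonneg _)
  have hPu : ∑ i ∈ range (n 0 + n 1 + n 2 + n 3), dP u ((succ E)^[i] d₀) ^ 2 ≤ Eu :=
    le_add_of_nonneg_left (sum_nonneg fun _ _ ↦ sq_nonneg _)
  have hPw : ∑ i ∈ range (n 0 + n 1 + n 2 + n 3), dP w ((succ E)^[i] d₀) ^ 2 ≤ Ew :=
    le_add_of_nonneg_left (sum_nonneg fun _ _ ↦ sq_nonneg _)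
  have hfilt : ∀ (P : Site 2 × Fin 4 → Prop) [DecidablePred P] (v : Site 2 ⊕ (Site 2 × Fin 4) → ℝ),
      ∑ a ∈ (arrows E).filter P, dA v a ^ 2 ≤ ∑ a ∈ arrows E, dA v a ^ 2 := fun P _ v ↦
    sum_le_sum_of_subset_of_nonneg (filter_subset _ _) fun _ _ _ ↦ sq_nonneg _
  have hQu := hR.sum_quadS_le u
  have hQw := hR.sum_quadS_le w
  have hsq1 : √(1 : ℝ) = 1 := Real.sqrt_one
  have hsq25 : √(25 : ℝ) = 5 := by
    rw [show (25 : ℝ) = 5 ^ 2 by norm_num, Real.sqrt_sq (by norm_num)]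
  have hsq100 : √(100 : ℝ) = 10 := by
    rw [show (100 : ℝ) = 10 ^ 2 by norm_num, Real.sqrt_sq (by norm_num)]
  -- (a) pendant products
  have hT1 : |∑ i ∈ range (n 0 + n 1 + n 2 + n 3), dP u ((succ E)^[i] d₀) * dP w ((succ E)^[i] d₀)| ≤ √Eu * √Ew := by
    refine (abs_sum_le_of_sq_le (range (n 0 + n 1 + n 2 + n 3)) _ (fun i ↦ dP u ((succ E)^[i] d₀) ^ 2)
      (fun i ↦ dP w ((succ E)^[i] d₀) ^ 2) zero_le_one (fun _ ↦ sq_nonneg _)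
      (fun _ ↦ sq_nonneg _) (fun i _ ↦ by ring_nf; rfl)).trans ?_
    rw [hsq1, one_mul]
    exact mul_le_mul (Real.sqrt_le_sqrt hPu) (Real.sqrt_le_sqrt hPw) (Real.sqrt_nonneg _)
      (Real.sqrt_nonneg _)
  -- (b) face wedges
  have hT2 : |∑ s ∈ faces E, ∑ j : Fin 4, th u w (corner s j, j)| ≤ 5 * (√Eu * √Ew) := by
    refine (abs_sum_le_of_sq_le (faces E) _ (fun s ↦ ∑ j : Fin 4, dA u (corner s j, j) ^ 2)
      (fun s ↦ ∑ j : Fin 4, dA w (corner s j, j) ^ 2) (by norm_num : (0 : ℝ) ≤ 25)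
      (fun _ ↦ sum_nonneg fun _ _ ↦ sq_nonneg _) (fun _ ↦ sum_nonneg fun _ _ ↦ sq_nonneg _)
      (fun s _ ↦ face_wedge_sq_le u w s)).trans ?_
    rw [hsq25, sum_faces_sides (E := E) (fun a ↦ dA u a ^ 2),
      sum_faces_sides (E := E) (fun a ↦ dA w a ^ 2), mul_assoc]
    refine mul_le_mul_of_nonneg_left (mul_le_mul (Real.sqrt_le_sqrt ((hfilt _ u).trans hAu))
      (Real.sqrt_le_sqrt ((hfilt _ w).trans hAw)) (Real.sqrt_nonneg _) (Real.sqrt_nonneg _))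
      (by norm_num)
  -- (c), (d) paired remainders
  have hT34 : ∀ (P : Site 2 × Fin 4 → Prop) [DecidablePred P],
      |∑ a ∈ (arrows E).filter P, dA u a * dA w a| ≤ √Eu * √Ew := fun P _ ↦ by
    refine (abs_sum_le_of_sq_le _ _ (fun a ↦ dA u a ^ 2) (fun a ↦ dA w a ^ 2) zero_le_one
      (fun _ ↦ sq_nonneg _) (fun _ ↦ sq_nonneg _) (fun a _ ↦ by ring_nf; rfl)).trans ?_
    rw [hsq1, one_mul]
    exact mul_le_mul (Real.sqrt_le_sqrt ((hfilt _ u).trans hAu))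
      (Real.sqrt_le_sqrt ((hfilt _ w).trans hAw)) (Real.sqrt_nonneg _) (Real.sqrt_nonneg _)
  have hT3 := hT34 (fun a ↦ ¬ InF E (rsq a) ∧ ¬ InF E (lsq a))
  have hT4 := hT34 (fun a ↦ InF E (lsq a) ∧ InF E (rsq a))
  -- (e) quad wedges
  have h2u : √(∑ i ∈ range (n 0 + n 1 + n 2 + n 3), quadS E u ((succ E)^[i] d₀)) ≤ √2 * √Eu := by
    rw [← Real.sqrt_mul (by norm_num)]
    exact Real.sqrt_le_sqrt hQu
  have h2w : √(∑ i ∈ range (n 0 + n 1 + n 2 + n 3), quadS E w ((succ E)^[i] d₀)) ≤ √2 * √Ew := by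
    rw [← Real.sqrt_mul (by norm_num)]
    exact Real.sqrt_le_sqrt hQw
  have hsq2 : √(2 : ℝ) * √2 = 2 := Real.mul_self_sqrt (by norm_num)
  have hT5 : |∑ i ∈ range (n 0 + n 1 + n 2 + n 3), quadX E u w ((succ E)^[i] d₀)| ≤ 10 * (√Eu * √Ew) := by
    refine (abs_sum_le_of_sq_le (range (n 0 + n 1 + n 2 + n 3)) _ (fun i ↦ quadS E u ((succ E)^[i] d₀))
      (fun i ↦ quadS E w ((succ E)^[i] d₀)) (by norm_num : (0 : ℝ) ≤ 25)
      (fun _ ↦ ?_) (fun _ ↦ ?_) (fun i _ ↦ quadX_sq_le u w _)).trans ?_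
    · unfold quadS; positivity
    · unfold quadS; positivity
    rw [hsq25]
    calc 5 * √(∑ i ∈ range (n 0 + n 1 + n 2 + n 3), quadS E u ((succ E)^[i] d₀)) *
          √(∑ i ∈ range (n 0 + n 1 + n 2 + n 3), quadS E w ((succ E)^[i] d₀))
        ≤ 5 * (√2 * √Eu) * (√2 * √Ew) := by gcongr
      _ = 10 * (√Eu * √Ew) := by linear_combination (5 * √Eu * √Ew) * hsq2
  -- (f), (g) the two corner products
  have hcorner : ∀ i < n 0 + n 1 + n 2 + n 3, |(U (i + 1) - U i) * (W (i + 1) - W i)| ≤ 10 * (√Eu * √Ew) := by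
    intro i hi
    have hu := dExt_sq_le (E := E) u ((succ E)^[i] d₀)
    have hw := dExt_sq_le (E := E) w ((succ E)^[i] d₀)
    rw [← hDsucc] at hu hw
    have hqu : quadS E u ((succ E)^[i] d₀) ≤ ∑ j ∈ range (n 0 + n 1 + n 2 + n 3), quadS E u ((succ E)^[j] d₀) :=
      single_le_sum (f := fun j ↦ quadS E u ((succ E)^[j] d₀))
        (fun j _ ↦ by unfold quadS; positivity) (mem_range.2 hi)
    have hqw : quadS E w ((succ E)^[i] d₀) ≤ ∑ j ∈ range (n 0 + n 1 + n 2 + n 3), quadS E w ((succ E)^[j] d₀) :=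
      single_le_sum (f := fun j ↦ quadS E w ((succ E)^[j] d₀))
        (fun j _ ↦ by unfold quadS; positivity) (mem_range.2 hi)
    have h := abs_le_of_sq_le (t := (U (i + 1) - U i) * (W (i + 1) - W i)) (c := 100)
      (F := Eu) (G := Ew) (by norm_num) hEu0 (by
        rw [mul_pow]
        calc (U (i + 1) - U i) ^ 2 * (W (i + 1) - W i) ^ 2
            ≤ (5 * quadS E u ((succ E)^[i] d₀)) * (5 * quadS E w ((succ E)^[i] d₀)) :=
              mul_le_mul hu hw (sq_nonneg _) (by unfold quadS; positivity)
          _ ≤ (5 * (2 * Eu)) * (5 * (2 * Ew)) := by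
              gcongr
              · unfold quadS; positivity
              · exact hqu.trans hQu
              · exact hqw.trans hQw
          _ = 100 * Eu * Ew := by ring)
    rwa [hsq100, mul_assoc] at h
  have hcN := hcorner (n 0 + n 1 + n 2 + n 3 - 1) (by omega)
  have hcB := hcorner (n 0 + n 1 - 1) (by have := hR.pos 1; have := hR.pos 2; omega)
  rw [Nat.sub_add_cancel hN0] at hcN
  rw [Nat.sub_add_cancel (by have := hR.pos 1; omega)] at hcB
  -- Step 5: combine
  have key : (1 : ℝ) =
      -∑ i ∈ range (n 0 + n 1 + n 2 + n 3), dP u ((succ E)^[i] d₀) * dP w ((succ E)^[i] d₀) +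
        (∑ s ∈ faces E, ∑ j : Fin 4, th u w (corner s j, j) +
          -(1 / 2) * ∑ a ∈ (arrows E).filter (fun a ↦ ¬ InF E (rsq a) ∧ ¬ InF E (lsq a)),
            dA u a * dA w a -
          -(1 / 2) * ∑ a ∈ (arrows E).filter (fun a ↦ InF E (lsq a) ∧ InF E (rsq a)),
            dA u a * dA w a) -
        ∑ i ∈ range (n 0 + n 1 + n 2 + n 3), quadX E u w ((succ E)^[i] d₀) +
      (U (n 0 + n 1 + n 2 + n 3) - U (n 0 + n 1 + n 2 + n 3 - 1)) * (W (n 0 + n 1 + n 2 + n 3) - W (n 0 + n 1 + n 2 + n 3 - 1)) +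
      (U (n 0 + n 1) - U (n 0 + n 1 - 1)) * (W (n 0 + n 1) - W (n 0 + n 1 - 1)) := by
    rw [hfaces, ← hpair1, ← hpair2, ← hsplit, ← hS, hpoly]
    ring
  have b1 := neg_abs_le (∑ i ∈ range (n 0 + n 1 + n 2 + n 3), dP u ((succ E)^[i] d₀) * dP w ((succ E)^[i] d₀))
  have b2 := le_abs_self (∑ s ∈ faces E, ∑ j : Fin 4, th u w (corner s j, j))
  have b3 := neg_abs_le (∑ a ∈ (arrows E).filter (fun a ↦ ¬ InF E (rsq a) ∧ ¬ InF E (lsq a)),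
    dA u a * dA w a)
  have b4 := le_abs_self (∑ a ∈ (arrows E).filter (fun a ↦ InF E (lsq a) ∧ InF E (rsq a)),
    dA u a * dA w a)
  have b5 := neg_abs_le (∑ i ∈ range (n 0 + n 1 + n 2 + n 3), quadX E u w ((succ E)^[i] d₀))
  have b6 := le_abs_self ((U (n 0 + n 1 + n 2 + n 3) - U (n 0 + n 1 + n 2 + n 3 - 1)) * (W (n 0 + n 1 + n 2 + n 3) - W (n 0 + n 1 + n 2 + n 3 - 1)))
  have b7 := le_abs_self ((U (n 0 + n 1) - U (n 0 + n 1 - 1)) * (W (n 0 + n 1) - W (n 0 + n 1 - 1)))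
  have hpos : 0 ≤ √Eu * √Ew := mul_nonneg (Real.sqrt_nonneg _) (Real.sqrt_nonneg _)
  linarith [key, b1, b2, b3, b4, b5, b6, b7, hT1, hT2, hT3, hT4, hT5, hcN, hcB, hpos]

end Assembly

/-! ### The energy of `Ω̄` as a finite sum -/

section EnergyIdentity

variable {E : Finset (Sym2 (Site 2))} {d₀ : Site 2 × Fin 4} {n : Fin 4 → ℕ}

/-- The pendant edge of `Ω̄` at the dart `d`. [folklore] -/
def pend (d : Site 2 × Fin 4) : Sym2 (Site 2 ⊕ (Site 2 × Fin 4)) := s(.inl d.1, .inr d)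

/-- Distinct darts have distinct pendant edges. [folklore] -/
theorem pend_injective : Function.Injective pend := by
  intro d d' h
  rcases Sym2.eq_iff.1 h with ⟨-, h2⟩ | ⟨h1, -⟩
  · exact Sum.inr_injective h2
  · exact absurd h1 Sum.inl_ne_inr

/-- A pendant edge is not an image of a lattice edge. [folklore] -/
theorem map_inl_ne_pend (e : Sym2 (Site 2)) (d : Site 2 × Fin 4) :
    Sym2.map Sum.inl e ≠ pend d := by
  induction e using Sym2.ind with
  | h x y =>
    rw [Sym2.map_mk, pend, Ne, Sym2.eq_iff]
    rintro (⟨-, h⟩ | ⟨h, -⟩)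
    · exact Sum.inl_ne_inr h
    · exact Sum.inl_ne_inr h

/-- **The edges of `Ω̄` along a rectangle**: the images of the edges of `E` and the pendant edges of
the darts of one period of the boundary cycle. [folklore] -/
theorem IsRect.edgeSet_extGraph (hR : IsRect E d₀ n) :
    (extGraph E).edgeSet = ↑(E.image (Sym2.map Sum.inl) ∪
      (range (n 0 + n 1 + n 2 + n 3)).image (fun i ↦ pend ((succ E)^[i] d₀))) := by
  ext e
  rw [Finset.coe_union, Set.mem_union, Finset.mem_coe, Finset.mem_coe, Finset.mem_image,
    Finset.mem_image]
  induction e using Sym2.ind with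
  | h a b =>
    rw [SimpleGraph.mem_edgeSet]
    constructor
    · intro hab
      obtain a | d := a <;> obtain b | d' := b
      · exact Or.inl ⟨s(a, b), (extGraph_adj_inl_inl.1 hab).2, by simp⟩
      · obtain ⟨hd, hx⟩ := extGraph_adj_inl_inr.1 hab
        obtain ⟨i, hi, rfl⟩ := hR.cover _ hd
        exact Or.inr ⟨i, mem_range.2 hi, by rw [pend, hx]⟩
      · obtain ⟨hd, hx⟩ := extGraph_adj_inl_inr.1 hab.symm
        obtain ⟨i, hi, rfl⟩ := hR.cover _ hd
        exact Or.inr ⟨i, mem_range.2 hi, by rw [pend, hx, Sym2.eq_swap]⟩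
      · exact absurd hab extGraph_not_adj_inr_inr
    · rintro (⟨e, he, hmap⟩ | ⟨i, -, hp⟩)
      · rw [← SimpleGraph.mem_edgeSet, ← hmap]
        induction e using Sym2.ind with
        | h x y =>
          rw [Sym2.map_mk, SimpleGraph.mem_edgeSet, extGraph_adj_inl_inl]
          exact ⟨(SimpleGraph.mem_edgeSet _).1 (hR.subset_edgeSet _ he) |>.ne, he⟩
      · rw [← SimpleGraph.mem_edgeSet, ← hp, pend, SimpleGraph.mem_edgeSet]
        exact extGraph_adj_inl_inr.2 ⟨hR.isExtDart_iterate i, rfl⟩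

/-- **The Dirichlet energy of `Ω̄` along a rectangle is a finite sum**: the squared increments over
the edges of `E` plus those over the pendant edges of one period of the boundary cycle. [folklore] -/
theorem IsRect.networkEnergy_eq (hR : IsRect E d₀ n) (u : Site 2 ⊕ (Site 2 × Fin 4) → ℝ) :
    networkEnergy (extGraph E) 1 u = ENNReal.ofReal (∑ e ∈ E, sqIncr (u ∘ Sum.inl) e +
      ∑ i ∈ range (n 0 + n 1 + n 2 + n 3), dP u ((succ E)^[i] d₀) ^ 2) := by
  classical
  have hES := hR.edgeSet_extGraph
  set S₁ := E.image (Sym2.map (Sum.inl : Site 2 → Site 2 ⊕ (Site 2 × Fin 4))) with hS₁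
  set S₂ := (range (n 0 + n 1 + n 2 + n 3)).image (fun i ↦ pend ((succ E)^[i] d₀)) with hS₂
  have hdisj : Disjoint S₁ S₂ := by
    rw [Finset.disjoint_left]
    intro e he1 he2
    obtain ⟨e', -, rfl⟩ := mem_image.1 he1
    obtain ⟨i, -, hi⟩ := mem_image.1 he2
    exact map_inl_ne_pend e' _ hi.symm
  have hinj₂ : Set.InjOn (fun i ↦ pend ((succ E)^[i] d₀)) ↑(range (n 0 + n 1 + n 2 + n 3)) := by
    intro i hi j hj h
    rw [coe_range, Set.mem_Iio] at hi hj
    exact hR.injOn i j hi hj (pend_injective h)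
  unfold networkEnergy
  rw [tsum_eq_sum (s := S₁ ∪ S₂) fun e he ↦ Set.indicator_of_notMem
    (by rw [hES, Finset.mem_coe]; exact he) _]
  rw [sum_congr rfl fun e he ↦ Set.indicator_of_mem
    (show e ∈ (extGraph E).edgeSet by rw [hES, Finset.mem_coe]; exact he) _]
  rw [sum_union hdisj, sum_image fun x _ y _ h ↦ Sym2.map.injective Sum.inl_injective h,
    sum_image hinj₂, ENNReal.ofReal_add (sum_nonneg fun _ _ ↦ sqIncr_nonneg _ _)
      (sum_nonneg fun _ _ ↦ sq_nonneg _),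
    ENNReal.ofReal_sum_of_nonneg fun _ _ ↦ sqIncr_nonneg _ _,
    ENNReal.ofReal_sum_of_nonneg fun _ _ ↦ sq_nonneg _]
  simp only [Pi.one_apply, ENNReal.coe_one, one_mul]
  congr 1
  refine sum_congr rfl fun e _ ↦ ?_
  induction e using Sym2.ind with
  | h x y => simp [sqIncr_mk]

/-- Two arrows carry the same edge iff they are equal or mutually reverse. [folklore] -/
theorem eq_or_eq_rev_of_aedge_eq {a b : Site 2 × Fin 4} (h : aedge a = aedge b) :
    a = b ∨ a = rev b := by
  obtain ⟨p, m⟩ := a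
  obtain ⟨q, l⟩ := b
  rw [aedge_mk, aedge_mk, Sym2.eq_iff] at h
  rcases h with ⟨rfl, h2⟩ | ⟨rfl, h2⟩
  · left
    rw [dir_injective (add_left_cancel h2)]
  · right
    rw [add_assoc, add_eq_left, dir_add_dir_eq_zero_iff] at h2
    rw [rev_mk, h2]

/-- **Each edge carries at most two arrows**, so the arrow form of the energy is at most twice the
edge form. [folklore] -/
theorem sum_arrows_dA_sq_le (u : Site 2 ⊕ (Site 2 × Fin 4) → ℝ) :
    ∑ a ∈ arrows E, dA u a ^ 2 ≤ 2 * ∑ e ∈ E, sqIncr (u ∘ Sum.inl) e := by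
  classical
  rw [← sum_fiberwise_of_maps_to (g := aedge) (t := E) (fun a ha ↦ mem_arrows.1 ha), mul_sum]
  refine sum_le_sum fun e _ ↦ ?_
  have hval : ∀ a ∈ (arrows E).filter (fun a ↦ aedge a = e), dA u a ^ 2 = sqIncr (u ∘ Sum.inl) e := by
    intro a ha
    rw [mem_filter] at ha
    rw [← ha.2, aedge, sqIncr_mk, dA]
    simp only [Function.comp_apply]
    ring
  rw [sum_congr rfl hval, sum_const, nsmul_eq_mul]
  refine mul_le_mul_of_nonneg_right ?_ (sqIncr_nonneg _ _)
  -- at most two arrows on `e`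
  by_cases hne : ((arrows E).filter (fun a ↦ aedge a = e)).Nonempty
  · obtain ⟨a₀, ha₀⟩ := hne
    have hsub : (arrows E).filter (fun a ↦ aedge a = e) ⊆ {a₀, rev a₀} := by
      intro a ha
      rw [mem_filter] at ha ha₀
      rw [mem_insert, mem_singleton]
      exact eq_or_eq_rev_of_aedge_eq (ha.2.trans ha₀.2.symm)
    calc (((arrows E).filter (fun a ↦ aedge a = e)).card : ℝ) ≤ ({a₀, rev a₀} : Finset _).card := by
          exact_mod_cast card_le_card hsub
      _ ≤ 2 := by exact_mod_cast card_le_two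
  · rw [not_nonempty_iff_eq_empty.1 hne, card_empty]
    norm_num

/-- The real energy `rEnergy` is at most twice the Dirichlet energy of `Ω̄`. [folklore] -/
theorem IsRect.rEnergy_le (hR : IsRect E d₀ n) (u : Site 2 ⊕ (Site 2 × Fin 4) → ℝ) :
    ENNReal.ofReal (rEnergy E d₀ n u) ≤ 2 * networkEnergy (extGraph E) 1 u := by
  rw [hR.networkEnergy_eq, ← ENNReal.ofReal_ofNat 2, ← ENNReal.ofReal_mul (by norm_num)]
  refine ENNReal.ofReal_le_ofReal ?_
  unfold rEnergy
  have h := sum_arrows_dA_sq_le (E := E) u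
  have hP : 0 ≤ ∑ i ∈ range (n 0 + n 1 + n 2 + n 3), dP u ((succ E)^[i] d₀) ^ 2 :=
    sum_nonneg fun _ _ ↦ sq_nonneg _
  linarith

end EnergyIdentity

/-! ### The upper bound `ℓ_Ω̄[A,C] · ℓ_Ω̄[B,D] ≤ K` -/

section UpperBound

variable {E : Finset (Sym2 (Site 2))} {d₀ : Site 2 × Fin 4} {n : Fin 4 → ℕ}

/-- `lo n 0 = 0`, `lo n 1 = n 0`, `lo n 2 = n 0 + n 1`, `lo n 3 = n 0 + n 1 + n 2`. [folklore] -/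
theorem lo_eq (n : Fin 4 → ℕ) :
    lo n 0 = 0 ∧ lo n 1 = n 0 ∧ lo n 2 = n 0 + n 1 ∧ lo n 3 = n 0 + n 1 + n 2 := by
  simp [lo]

/-- Boundary values on an external arc, position by position. [folklore] -/
theorem eqOn_extArc_iff {u : Site 2 ⊕ (Site 2 × Fin 4) → ℝ} {c : ℝ} {j : Fin 4} :
    (extArc E d₀ n j).EqOn u (fun _ ↦ c) ↔
      ∀ i, lo n j ≤ i → i < lo n j + n j → u (.inr ((succ E)^[i] d₀)) = c := by
  constructor
  · intro h i h1 h2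
    exact h ⟨i, h1, h2, rfl⟩
  · rintro h _ ⟨i, h1, h2, rfl⟩
    exact h i h1 h2

/-- The effective conductance as an infimum over the subtype of admissible potentials. [folklore] -/
theorem effectiveConductance_eq_iInf_subtype {V : Type*} (G : SimpleGraph V) (c : Sym2 V → ℝ≥0)
    (A Z : Set V) :
    effectiveConductance G c A Z =
      ⨅ v : {v : V → ℝ // A.EqOn v 1 ∧ Z.EqOn v 0}, networkEnergy G c v.1 :=
  le_antisymm (le_iInf fun v ↦ effectiveConductance_le_networkEnergy v.2.1 v.2.2)
    (le_effectiveConductance fun v h1 h2 ↦ iInf_le_of_le ⟨v, h1, h2⟩ le_rfl)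

/-- **The product of the two conductances of a rectangle is bounded below**:
`𝒞(A_ext ↔ C_ext) · 𝒞(B_ext ↔ D_ext) ≥ 1/5476`. [folklore] -/
theorem IsRect.le_effectiveConductance_mul (hR : IsRect E d₀ n) :
    ENNReal.ofReal (1 / 5476) ≤
      effectiveConductance (extGraph E) 1 (extArc E d₀ n 0) (extArc E d₀ n 2) *
        effectiveConductance (extGraph E) 1 (extArc E d₀ n 1) (extArc E d₀ n 3) := by
  obtain ⟨hl0, hl1, hl2, hl3⟩ := lo_eq n
  -- admissible indicator potentials have finite energy
  have hdisj : ∀ {j j' : Fin 4}, lo n j + n j ≤ lo n j' → lo n j' + n j' ≤ n 0 + n 1 + n 2 + n 3 →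
      Disjoint (extArc E d₀ n j) (extArc E d₀ n j') := by
    intro j j' hjj hj'
    rw [Set.disjoint_left]
    rintro _ ⟨i, hi1, hi2, rfl⟩ ⟨i', hi1', hi2', h⟩
    have := hR.injOn i i' (by omega) (by omega) (Sum.inr_injective h)
    omega
  classical
  have hfin : ∀ {j j' : Fin 4}, Disjoint (extArc E d₀ n j) (extArc E d₀ n j') →
      ∃ v : {v : Site 2 ⊕ (Site 2 × Fin 4) → ℝ // (extArc E d₀ n j).EqOn v 1 ∧
        (extArc E d₀ n j').EqOn v 0}, networkEnergy (extGraph E) 1 v.1 ≠ ⊤ := by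
    intro j j' hd
    refine ⟨⟨fun x ↦ if x ∈ extArc E d₀ n j then 1 else 0, fun x hx ↦ by simp [hx],
      fun x hx ↦ by simp [Set.disjoint_right.1 hd hx]⟩, ?_⟩
    rw [hR.networkEnergy_eq]
    exact ENNReal.ofReal_ne_top
  rw [effectiveConductance_eq_iInf_subtype, effectiveConductance_eq_iInf_subtype]
  refine ENNReal.le_iInf_mul_iInf (hfin (hdisj (by omega) (by omega)))
    (hfin (hdisj (by omega) (by omega))) fun uu ww ↦ ?_
  obtain ⟨u, huA, huC⟩ := uu
  obtain ⟨w, hwB, hwD⟩ := ww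
  dsimp only
  -- the area inequality
  have h1 := hR.one_le_mul_sqrt_rEnergy u w
    (fun i hi ↦ huA ⟨i, by omega, by omega, rfl⟩)
    (fun i h1 h2 ↦ huC ⟨i, by omega, by omega, rfl⟩)
    (fun i h1 h2 ↦ hwB ⟨i, by omega, by omega, rfl⟩)
    (fun i h1 h2 ↦ hwD ⟨i, by omega, by omega, rfl⟩)
  -- in `ℝ≥0∞`
  have h2 : ENNReal.ofReal (1 / 1369) ≤
      ENNReal.ofReal (rEnergy E d₀ n u) * ENNReal.ofReal (rEnergy E d₀ n w) := by
    rw [← ENNReal.ofReal_mul (rEnergy_nonneg u)]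
    refine ENNReal.ofReal_le_ofReal ?_
    have hu := Real.sq_sqrt (rEnergy_nonneg (E := E) (d₀ := d₀) (n := n) u)
    have hw := Real.sq_sqrt (rEnergy_nonneg (E := E) (d₀ := d₀) (n := n) w)
    nlinarith [h1, Real.sqrt_nonneg (rEnergy E d₀ n u), Real.sqrt_nonneg (rEnergy E d₀ n w)]
  have h3 := mul_le_mul' (hR.rEnergy_le u) (hR.rEnergy_le w)
  have h5 : ENNReal.ofReal (1 / 1369) ≤
      networkEnergy (extGraph E) 1 u * networkEnergy (extGraph E) 1 w * 4 :=
    h2.trans (h3.trans_eq (by ring))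
  have h6 := ENNReal.div_le_of_le_mul h5
  have h7 : ENNReal.ofReal (1 / 5476) = ENNReal.ofReal (1 / 1369) / 4 := by
    rw [← ENNReal.ofReal_ofNat 4, ← ENNReal.ofReal_div_of_pos (by norm_num)]
    norm_num
  rwa [← h7] at h6

/-- **Upper bound of the self-duality** (Chelkak–Duminil-Copin–Hongler 2016, §3.3, third displayed
property, upper half): for every discrete topological rectangle,
`ℓ_Ω̄[(a_ext b_ext),(c_ext d_ext)] · ℓ_Ω̄[(b_ext c_ext),(d_ext a_ext)] ≤ 5476`.
[cite: ChelkakDuminilCopinHongler2016, §3.3 (self-duality of discrete extremal lengths)] -/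
theorem IsRect.extResistance_mul_extResistance_le (hR : IsRect E d₀ n) :
    extResistance E d₀ n 0 2 * extResistance E d₀ n 1 3 ≤ ENNReal.ofReal 5476 := by
  have h := hR.le_effectiveConductance_mul
  have hpos : ENNReal.ofReal (1 / 5476) ≠ 0 := by
    rw [Ne, ENNReal.ofReal_eq_zero, not_le]; norm_num
  have hne : effectiveConductance (extGraph E) 1 (extArc E d₀ n 0) (extArc E d₀ n 2) *
      effectiveConductance (extGraph E) 1 (extArc E d₀ n 1) (extArc E d₀ n 3) ≠ 0 :=
    fun h0 ↦ hpos (le_zero_iff.1 (h0 ▸ h))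
  unfold extResistance effectiveResistance
  rw [← ENNReal.mul_inv (Or.inl (left_ne_zero_of_mul hne)) (Or.inr (right_ne_zero_of_mul hne))]
  rw [one_div, ENNReal.ofReal_inv_of_pos (by norm_num : (0 : ℝ) < 5476)] at h
  exact ENNReal.inv_le_iff_inv_le.2 h

end UpperBound









end DiscreteRect

end Literature.Probability.LatticeModels

end
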